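import Summits.Langlands.Langlands.Theorems.RationalPeriodQuarterAnalyticCoreOneFrac

/-!
# `AnalyticCore` (child 2 of the lens-1-g38 split of `RationalPeriodQuarter.SemiAnalyticRigidity`) — Möbius algebra and the `γ₀`-tails

(1) Composition of a polynomial / fraction with a Möbius map `z ↦ (a + b z)/(c + d z)` is again a fraction
(explicit, by induction on the polynomial).  (2) A piecewise-rational `ρ` is ONE fraction on each side of EVERY
point (rigidity along the break-free interval next to the point).  (3) THE `γ₀`-TAILS: in the coordinate
`u = 1/(N t + 1)` at infinity (so `t = τ u := (1 - u)/(N u)` and `t/(N t + 1) = (1 - u)/N`), the weight `-1` identity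
for `γ₀ = (1 0; N 1)`, tameness of `h = f - ρ` at `γ₀ · ∞ = 1/N` and the tail pieces give
`h (τ u) = |u| · g₀ ((1 - u)/N) + (a fraction in u)` for all small `u > 0`, resp. `u < 0`.
-/

set_option linter.dupNamespace false

namespace Summit.Langlands.Langlands.Theorems

open Filter Set Topology Polynomial

/-- Möbius composition of a polynomial. -/
theorem anCore_mobius (a b c d : ℂ) (P : ℂ[X]) :
    ∃ P' : ℂ[X], ∃ k : ℕ, ∀ z : ℂ, c + d * z ≠ 0 →
      P.eval ((a + b * z) / (c + d * z)) = P'.eval z / (c + d * z) ^ k := by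
  induction P using Polynomial.induction_on' with
  | add P Q hP hQ =>
    obtain ⟨P', k, hP'⟩ := hP
    obtain ⟨Q', l, hQ'⟩ := hQ
    refine ⟨P' * (C c + C d * X) ^ l + Q' * (C c + C d * X) ^ k, k + l, fun z hz => ?_⟩
    rw [Polynomial.eval_add, hP' z hz, hQ' z hz]
    simp only [Polynomial.eval_add, Polynomial.eval_mul, Polynomial.eval_pow, Polynomial.eval_C,
      Polynomial.eval_X]
    rw [pow_add]
    field_simp
  | monomial n r =>
    refine ⟨C r * (C a + C b * X) ^ n, n, fun z hz => ?_⟩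
    simp only [Polynomial.eval_monomial, Polynomial.eval_mul, Polynomial.eval_pow, Polynomial.eval_C,
      Polynomial.eval_add, Polynomial.eval_X]
    rw [div_pow, mul_div_assoc]

/-- Möbius composition of a fraction (keeping track of the domain). -/
theorem anCore_mobius_frac (a b c d : ℂ) (P Q : ℂ[X]) :
    ∃ P'' Q'' : ℂ[X], ∀ z : ℂ, c + d * z ≠ 0 → Q.eval ((a + b * z) / (c + d * z)) ≠ 0 →
      Q''.eval z ≠ 0 ∧ P.eval ((a + b * z) / (c + d * z)) / Q.eval ((a + b * z) / (c + d * z)) =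
        P''.eval z / Q''.eval z := by
  obtain ⟨P', k, hP'⟩ := anCore_mobius a b c d P
  obtain ⟨Q', l, hQ'⟩ := anCore_mobius a b c d Q
  refine ⟨P' * (C c + C d * X) ^ l, Q' * (C c + C d * X) ^ k, fun z hz hQz => ?_⟩
  have hQ'z : Q'.eval z ≠ 0 := by
    intro h0
    rw [hQ' z hz, h0, zero_div] at hQz
    exact hQz rfl
  simp only [Polynomial.eval_mul, Polynomial.eval_pow, Polynomial.eval_add, Polynomial.eval_C,
    Polynomial.eval_X]
  refine ⟨mul_ne_zero hQ'z (pow_ne_zero _ hz), ?_⟩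
  rw [hP' z hz, hQ' z hz]
  field_simp

/-- A gap to the right of `x` free of a finite real set. -/
theorem anCore_exists_gt_gap (E : Finset ℝ) (x : ℝ) : ∃ b : ℝ, x < b ∧ ∀ e ∈ E, e ≤ x ∨ b ≤ e := by
  classical
  by_cases hne : (E.filter (fun e => x < e)).Nonempty
  · refine ⟨(E.filter (fun e => x < e)).min' hne, ?_, fun e he => ?_⟩
    · have := Finset.min'_mem _ hne
      exact (Finset.mem_filter.1 this).2
    · by_cases hxe : x < e
      · exact Or.inr (Finset.min'_le _ _ (Finset.mem_filter.2 ⟨he, hxe⟩))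
      · exact Or.inl (not_lt.1 hxe)
  · refine ⟨x + 1, by linarith, fun e he => ?_⟩
    by_cases hxe : x < e
    · exact absurd ⟨e, Finset.mem_filter.2 ⟨he, hxe⟩⟩ hne
    · exact Or.inl (not_lt.1 hxe)

/-- A gap to the left of `x` free of a finite real set. -/
theorem anCore_exists_lt_gap (E : Finset ℝ) (x : ℝ) : ∃ a : ℝ, a < x ∧ ∀ e ∈ E, e ≤ a ∨ x ≤ e := by
  classical
  obtain ⟨b, hb, hgap⟩ := anCore_exists_gt_gap (E.image (fun e => -e)) (-x)
  refine ⟨-b, by linarith, fun e he => ?_⟩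
  rcases hgap (-e) (Finset.mem_image.2 ⟨e, he, rfl⟩) with h | h
  · exact Or.inr (by linarith)
  · exact Or.inl (by linarith)

/-- A piecewise-rational function is ONE fraction on the right side of every point. -/
theorem anCore_pw_onesided_right (ρ : ℝ → ℂ) (E : Finset ℝ)
    (hloc : ∀ x : ℝ, x ∉ E → ∃ P Q : ℂ[X], ∀ᶠ (t : ℝ) in 𝓝 x,
      Q.eval (t : ℂ) ≠ 0 ∧ ρ t = P.eval (t : ℂ) / Q.eval (t : ℂ)) (x : ℝ) :
    ∃ P Q : ℂ[X], ∀ᶠ (t : ℝ) in 𝓝[>] x, Q.eval (t : ℂ) ≠ 0 ∧ ρ t = P.eval (t : ℂ) / Q.eval (t : ℂ) := by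
  obtain ⟨b, hb, hgap⟩ := anCore_exists_gt_gap E x
  have hI : ∀ t ∈ Set.Ioo x b, t ∉ E := by
    intro t ht htE
    rcases hgap t htE with h | h
    · linarith [ht.1]
    · linarith [ht.2]
  have han : ∀ t ∈ Set.Ioo x b, AnalyticAt ℝ ρ t := by
    intro t ht
    obtain ⟨P, Q, hPQ⟩ := hloc t (hI t ht)
    exact anCore_analyticAt_of_local_frac ρ t P Q hPQ
  have hy : (x + b) / 2 ∈ Set.Ioo x b := ⟨by linarith, by linarith⟩
  obtain ⟨P, Q, hPQ⟩ := hloc _ (hI _ hy)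
  have hQ : Q ≠ 0 := by
    intro h0; have := hPQ.self_of_nhds.1; rw [h0, Polynomial.eval_zero] at this; exact this rfl
  obtain ⟨P₁, Q₁, hQ₁, hno, hred⟩ := anCore_reduce P Q hQ
  have hrig := anCore_rigid ρ (Set.Ioo x b) isPreconnected_Ioo han P₁ Q₁ hno _ hy
    (hPQ.mono fun t ht => ⟨(hred _ ht.1).1, by rw [ht.2, (hred _ ht.1).2]⟩)
  refine ⟨P₁, Q₁, ?_⟩
  filter_upwards [Ioo_mem_nhdsGT hb] with t ht using hrig t ht

/-- A piecewise-rational function is ONE fraction on the left side of every point. -/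
theorem anCore_pw_onesided_left (ρ : ℝ → ℂ) (E : Finset ℝ)
    (hloc : ∀ x : ℝ, x ∉ E → ∃ P Q : ℂ[X], ∀ᶠ (t : ℝ) in 𝓝 x,
      Q.eval (t : ℂ) ≠ 0 ∧ ρ t = P.eval (t : ℂ) / Q.eval (t : ℂ)) (x : ℝ) :
    ∃ P Q : ℂ[X], ∀ᶠ (t : ℝ) in 𝓝[<] x, Q.eval (t : ℂ) ≠ 0 ∧ ρ t = P.eval (t : ℂ) / Q.eval (t : ℂ) := by
  obtain ⟨a, ha, hgap⟩ := anCore_exists_lt_gap E x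
  have hI : ∀ t ∈ Set.Ioo a x, t ∉ E := by
    intro t ht htE
    rcases hgap t htE with h | h
    · linarith [ht.1]
    · linarith [ht.2]
  have han : ∀ t ∈ Set.Ioo a x, AnalyticAt ℝ ρ t := by
    intro t ht
    obtain ⟨P, Q, hPQ⟩ := hloc t (hI t ht)
    exact anCore_analyticAt_of_local_frac ρ t P Q hPQ
  have hy : (a + x) / 2 ∈ Set.Ioo a x := ⟨by linarith, by linarith⟩
  obtain ⟨P, Q, hPQ⟩ := hloc _ (hI _ hy)
  have hQ : Q ≠ 0 := by
    intro h0; have := hPQ.self_of_nhds.1; rw [h0, Polynomial.eval_zero] at this; exact this rfl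
  obtain ⟨P₁, Q₁, hQ₁, hno, hred⟩ := anCore_reduce P Q hQ
  have hrig := anCore_rigid ρ (Set.Ioo a x) isPreconnected_Ioo han P₁ Q₁ hno _ hy
    (hPQ.mono fun t ht => ⟨(hred _ ht.1).1, by rw [ht.2, (hred _ ht.1).2]⟩)
  refine ⟨P₁, Q₁, ?_⟩
  filter_upwards [Ioo_mem_nhdsLT ha] with t ht using hrig t ht

/-- Sum of four fractions with polynomial weights, as one fraction (the shape used for the `γ₀`-tails). -/
theorem anCore_four_fractions (A B P Q P₂ Q₂ P₃ Q₃ : ℂ[X]) :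
    ∃ Pw Qw : ℂ[X], ∀ z : ℂ, B.eval z ≠ 0 → Q.eval z ≠ 0 → Q₂.eval z ≠ 0 → Q₃.eval z ≠ 0 →
      Qw.eval z ≠ 0 ∧ z * (A.eval z / B.eval z) + z * (P.eval z / Q.eval z) - P₂.eval z / Q₂.eval z -
        P₃.eval z / Q₃.eval z = Pw.eval z / Qw.eval z := by
  refine ⟨X * A * Q * Q₂ * Q₃ + X * P * B * Q₂ * Q₃ - P₂ * B * Q * Q₃ - P₃ * B * Q * Q₂,
    B * Q * Q₂ * Q₃, fun z hB hQ hQ₂ hQ₃ => ?_⟩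
  simp only [Polynomial.eval_mul, Polynomial.eval_add, Polynomial.eval_sub, Polynomial.eval_X]
  refine ⟨mul_ne_zero (mul_ne_zero (mul_ne_zero hB hQ) hQ₂) hQ₃, ?_⟩
  field_simp

/-- The coordinate at infinity: for `u ≠ 0`, with `τ u = (1 - u)/(N u)`: `N (τ u) + 1 = u⁻¹` and
`τ u / (N τ u + 1) = (1 - u)/N`. -/
theorem anCore_tau_identities (N : ℕ) (hN : 0 < N) (u : ℝ) (hu : u ≠ 0) :
    (N : ℝ) * ((1 - u) / ((N : ℝ) * u)) + 1 = u⁻¹ ∧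
      (1 - u) / ((N : ℝ) * u) / ((N : ℝ) * ((1 - u) / ((N : ℝ) * u)) + 1) = (1 - u) / N := by
  have hN' : (N : ℝ) ≠ 0 := by exact_mod_cast hN.ne'
  have h1 : (N : ℝ) * ((1 - u) / ((N : ℝ) * u)) + 1 = u⁻¹ := by field_simp; ring
  refine ⟨h1, ?_⟩
  rw [h1]
  field_simp

/-- THE RIGHT `γ₀`-TAIL in the coordinate `u = 1/(N t + 1) → 0⁺`. -/
theorem anCore_gamma0_tail_right (N : ℕ) (hN : 0 < N) (f ρ q₀ g₀ : ℝ → ℂ)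
    (P₀ Q₀ : ℂ[X]) (ε : ℝ) (hε : 0 < ε)
    (htame : ∀ t : ℝ, t ≠ (1 : ℝ) / N → |t - 1 / N| < ε →
      Q₀.eval (t : ℂ) ≠ 0 ∧ f t - ρ t = g₀ t + P₀.eval (t : ℂ) / Q₀.eval (t : ℂ))
    (Am Bm : ℂ[X]) (hρm : ∀ t : ℝ, t < (1 : ℝ) / N → (1 : ℝ) / N - ε < t →
      Bm.eval (t : ℂ) ≠ 0 ∧ ρ t = Am.eval (t : ℂ) / Bm.eval (t : ℂ))
    (Bρ : ℝ) (Pr Qr : ℂ[X])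
    (hρR : ∀ t : ℝ, Bρ < t → Qr.eval (t : ℂ) ≠ 0 ∧ ρ t = Pr.eval (t : ℂ) / Qr.eval (t : ℂ))
    (Bq : ℝ) (Pq Qq : ℂ[X])
    (hqR : ∀ t : ℝ, Bq < t → Qq.eval (t : ℂ) ≠ 0 ∧ q₀ t = Pq.eval (t : ℂ) / Qq.eval (t : ℂ))
    (T : ℝ) (hγ : ∀ t : ℝ, T < t →
      (((|(N : ℝ) * t + 1|⁻¹ : ℝ) : ℂ)) * f (t / ((N : ℝ) * t + 1)) - f t = q₀ t) :
    ∃ δ : ℝ, 0 < δ ∧ ∃ Pw Qw : ℂ[X], ∀ u : ℝ, 0 < u → u < δ →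
      Qw.eval (u : ℂ) ≠ 0 ∧ f ((1 - u) / ((N : ℝ) * u)) - ρ ((1 - u) / ((N : ℝ) * u)) =
        (u : ℂ) * g₀ ((1 - u) / N) + Pw.eval (u : ℂ) / Qw.eval (u : ℂ) := by
  have hN' : (0 : ℝ) < N := by exact_mod_cast hN
  have hNc : (N : ℂ) ≠ 0 := by exact_mod_cast hN.ne'
  -- the fractions in `u`
  set ℓ : ℂ[X] := C ((1 : ℂ) / N) - C ((1 : ℂ) / N) * X with hℓ
  have hℓev : ∀ u : ℝ, ℓ.eval (u : ℂ) = (((1 - u) / N : ℝ) : ℂ) := by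
    intro u; simp only [hℓ, Polynomial.eval_sub, Polynomial.eval_mul, Polynomial.eval_C,
      Polynomial.eval_X]; push_cast; ring
  obtain ⟨Pr', Qr', hr'⟩ := anCore_mobius_frac 1 (-1) 0 N Pr Qr
  obtain ⟨Pq', Qq', hq'⟩ := anCore_mobius_frac 1 (-1) 0 N Pq Qq
  obtain ⟨Pw, Qw, hw⟩ := anCore_four_fractions (Am.comp ℓ) (Bm.comp ℓ) (P₀.comp ℓ) (Q₀.comp ℓ)
    Pq' Qq' Pr' Qr'
  -- the bound: `u < δ` forces `τ u > max T Bρ Bq 0` and `u/N < ε`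
  set M : ℝ := max (max (max T Bρ) Bq) 0 with hM
  have hM0 : 0 ≤ M := le_max_right _ _
  refine ⟨min (1 / (1 + N * M)) (min (N * ε) 1), by positivity, Pw, Qw, fun u hu0 huδ => ?_⟩
  have hu1 : u < 1 / (1 + N * M) := lt_of_lt_of_le huδ (min_le_left _ _)
  have hu2 : u < N * ε := lt_of_lt_of_le huδ (le_trans (min_le_right _ _) (min_le_left _ _))
  have hu3 : u < 1 := lt_of_lt_of_le huδ (le_trans (min_le_right _ _) (min_le_right _ _))
  have huc : (u : ℂ) ≠ 0 := by exact_mod_cast hu0.ne'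
  -- τ u > M
  have hτ : M < (1 - u) / ((N : ℝ) * u) := by
    rw [lt_div_iff₀ (by positivity)]
    have : u * (1 + N * M) < 1 := by
      calc u * (1 + N * M) < 1 / (1 + N * M) * (1 + N * M) := by gcongr
        _ = 1 := by field_simp
    nlinarith
  have hTM : T ≤ M := le_trans (le_trans (le_max_left _ _) (le_max_left _ _)) (le_max_left _ _)
  have hτT : T < (1 - u) / ((N : ℝ) * u) := lt_of_le_of_lt hTM hτ
  have hτρ : Bρ < (1 - u) / ((N : ℝ) * u) :=
    lt_of_le_of_lt (le_trans (le_trans (le_max_right _ _) (le_max_left _ _)) (le_max_left _ _)) hτ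
  have hτq : Bq < (1 - u) / ((N : ℝ) * u) := lt_of_le_of_lt (le_trans (le_max_right _ _) (le_max_left _ _)) hτ
  -- the identities at `t = τ u`
  obtain ⟨hid1, hid2⟩ := anCore_tau_identities N hN u hu0.ne'
  have hγu := hγ _ hτT
  rw [hid2, hid1, abs_inv, inv_inv, abs_of_pos hu0] at hγu
  -- the point `(1 - u)/N` is just left of `1/N`
  have hlt : (1 - u) / (N : ℝ) < 1 / N := by
    rw [div_lt_div_iff_of_pos_right hN']; linarith
  have hgt : (1 : ℝ) / N - ε < (1 - u) / N := by
    have : (1 : ℝ) / N - (1 - u) / N = u / N := by field_simp; ring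
    have h2 : u / N < ε := by rw [div_lt_iff₀ hN']; linarith
    linarith
  have hne : (1 - u) / (N : ℝ) ≠ 1 / N := hlt.ne
  have habs : |(1 - u) / (N : ℝ) - 1 / N| < ε := by
    rw [abs_sub_lt_iff]; constructor <;> linarith
  obtain ⟨hQ₀, htm⟩ := htame _ hne habs
  obtain ⟨hBm, hρm'⟩ := hρm _ hlt hgt
  obtain ⟨hQr, hρr⟩ := hρR _ hτρ
  obtain ⟨hQq, hqq⟩ := hqR _ hτq
  -- Möbius forms
  have hmob : ((1 + (-1) * (u : ℂ)) / (0 + (N : ℂ) * u)) = ((((1 - u) / ((N : ℝ) * u)) : ℝ) : ℂ) := by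
    push_cast; ring
  have hden : (0 : ℂ) + (N : ℂ) * u ≠ 0 := by rw [zero_add]; exact mul_ne_zero hNc huc
  have hQr' : Qr.eval ((1 + (-1) * (u : ℂ)) / (0 + (N : ℂ) * u)) ≠ 0 := by rw [hmob]; exact hQr
  have hQq' : Qq.eval ((1 + (-1) * (u : ℂ)) / (0 + (N : ℂ) * u)) ≠ 0 := by rw [hmob]; exact hQq
  obtain ⟨hQr'', hrfrac⟩ := hr' (u : ℂ) hden hQr'
  obtain ⟨hQq'', hqfrac⟩ := hq' (u : ℂ) hden hQq'
  rw [hmob] at hrfrac hqfrac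
  have hBmℓ : (Bm.comp ℓ).eval (u : ℂ) ≠ 0 := by rw [Polynomial.eval_comp, hℓev]; exact hBm
  have hQ₀ℓ : (Q₀.comp ℓ).eval (u : ℂ) ≠ 0 := by rw [Polynomial.eval_comp, hℓev]; exact hQ₀
  obtain ⟨hQw, hsum⟩ := hw (u : ℂ) hBmℓ hQ₀ℓ hQq'' hQr''
  refine ⟨hQw, ?_⟩
  -- assemble
  have hf : f ((1 - u) / ((N : ℝ) * u)) = (u : ℂ) * f ((1 - u) / N) - q₀ ((1 - u) / ((N : ℝ) * u)) := by
    rw [← hγu]; ring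
  have hfx : f ((1 - u) / N) = ρ ((1 - u) / N) + (g₀ ((1 - u) / N) +
      P₀.eval ((((1 - u) / N : ℝ)) : ℂ) / Q₀.eval ((((1 - u) / N : ℝ)) : ℂ)) := by
    rw [← htm]; ring
  rw [hf, hfx, hρm', hqq, hρr, ← hsum]
  simp only [Polynomial.eval_comp, hℓev]
  rw [← hrfrac, ← hqfrac]
  ring

/-- THE LEFT `γ₀`-TAIL in the coordinate `u = 1/(N t + 1) → 0⁻`. -/
theorem anCore_gamma0_tail_left (N : ℕ) (hN : 0 < N) (f ρ q₀ g₀ : ℝ → ℂ)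
    (P₀ Q₀ : ℂ[X]) (ε : ℝ) (hε : 0 < ε)
    (htame : ∀ t : ℝ, t ≠ (1 : ℝ) / N → |t - 1 / N| < ε →
      Q₀.eval (t : ℂ) ≠ 0 ∧ f t - ρ t = g₀ t + P₀.eval (t : ℂ) / Q₀.eval (t : ℂ))
    (Ap Bp : ℂ[X]) (hρp : ∀ t : ℝ, (1 : ℝ) / N < t → t < (1 : ℝ) / N + ε →
      Bp.eval (t : ℂ) ≠ 0 ∧ ρ t = Ap.eval (t : ℂ) / Bp.eval (t : ℂ))
    (Bρ : ℝ) (Pl Ql : ℂ[X])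
    (hρL : ∀ t : ℝ, t < -Bρ → Ql.eval (t : ℂ) ≠ 0 ∧ ρ t = Pl.eval (t : ℂ) / Ql.eval (t : ℂ))
    (Bq : ℝ) (Pq Qq : ℂ[X])
    (hqL : ∀ t : ℝ, t < -Bq → Qq.eval (t : ℂ) ≠ 0 ∧ q₀ t = Pq.eval (t : ℂ) / Qq.eval (t : ℂ))
    (T : ℝ) (hγ : ∀ t : ℝ, t < -T →
      (((|(N : ℝ) * t + 1|⁻¹ : ℝ) : ℂ)) * f (t / ((N : ℝ) * t + 1)) - f t = q₀ t) :
    ∃ δ : ℝ, 0 < δ ∧ ∃ Pw Qw : ℂ[X], ∀ u : ℝ, u < 0 → -δ < u →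
      Qw.eval (u : ℂ) ≠ 0 ∧ f ((1 - u) / ((N : ℝ) * u)) - ρ ((1 - u) / ((N : ℝ) * u)) =
        -(u : ℂ) * g₀ ((1 - u) / N) + Pw.eval (u : ℂ) / Qw.eval (u : ℂ) := by
  have hN' : (0 : ℝ) < N := by exact_mod_cast hN
  have hNc : (N : ℂ) ≠ 0 := by exact_mod_cast hN.ne'
  set ℓ : ℂ[X] := C ((1 : ℂ) / N) - C ((1 : ℂ) / N) * X with hℓ
  have hℓev : ∀ u : ℝ, ℓ.eval (u : ℂ) = (((1 - u) / N : ℝ) : ℂ) := by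
    intro u; simp only [hℓ, Polynomial.eval_sub, Polynomial.eval_mul, Polynomial.eval_C,
      Polynomial.eval_X]; push_cast; ring
  obtain ⟨Pl', Ql', hl'⟩ := anCore_mobius_frac 1 (-1) 0 N Pl Ql
  obtain ⟨Pq', Qq', hq'⟩ := anCore_mobius_frac 1 (-1) 0 N Pq Qq
  obtain ⟨Pw, Qw, hw⟩ := anCore_four_fractions (-Ap.comp ℓ) (Bp.comp ℓ) (-P₀.comp ℓ) (Q₀.comp ℓ)
    Pq' Qq' Pl' Ql'
  set M : ℝ := max (max (max T Bρ) Bq) 0 with hM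
  have hM0 : 0 ≤ M := le_max_right _ _
  refine ⟨min (1 / (1 + N * M)) (min (N * ε) 1), by positivity, Pw, Qw, fun u hu0 huδ => ?_⟩
  have hu1 : -(1 / (1 + N * M)) < u := by
    have := min_le_left (1 / (1 + N * M)) (min (N * ε) 1); linarith
  have hu2 : -(N * ε) < u := by
    have := le_trans (min_le_right (1 / (1 + N * M)) _) (min_le_left (N * ε) 1); linarith
  have huc : (u : ℂ) ≠ 0 := by exact_mod_cast hu0.ne
  -- τ u < -M
  have hτ : (1 - u) / ((N : ℝ) * u) < -M := by
    rw [div_lt_iff_of_neg (by nlinarith)]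
    have h1 : -(u * (N * M)) ≤ N * M / (1 + N * M) := by
      have hle : -u ≤ 1 / (1 + N * M) := by linarith
      have h2 : -(u * (N * M)) = (-u) * (N * M) := by ring
      rw [h2]
      calc (-u) * (N * M) ≤ 1 / (1 + N * M) * (N * M) :=
            mul_le_mul_of_nonneg_right hle (mul_nonneg hN'.le hM0)
        _ = N * M / (1 + N * M) := by ring
    have h3 : N * M / (1 + N * M) < 1 := by
      rw [div_lt_one (by positivity)]; linarith
    nlinarith
  have hTM : T ≤ M := le_trans (le_trans (le_max_left _ _) (le_max_left _ _)) (le_max_left _ _)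
  have hτT : (1 - u) / ((N : ℝ) * u) < -T := by linarith
  have hτρ : (1 - u) / ((N : ℝ) * u) < -Bρ := by
    have := le_trans (le_trans (le_max_right T Bρ) (le_max_left _ Bq)) (le_max_left _ (0 : ℝ)); linarith
  have hτq : (1 - u) / ((N : ℝ) * u) < -Bq := by
    have := le_trans (le_max_right (max T Bρ) Bq) (le_max_left _ (0 : ℝ)); linarith
  obtain ⟨hid1, hid2⟩ := anCore_tau_identities N hN u hu0.ne
  have hγu := hγ _ hτT
  rw [hid2, hid1, abs_inv, inv_inv, abs_of_neg hu0] at hγu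
  -- the point `(1 - u)/N` is just right of `1/N`
  have hgt : (1 : ℝ) / N < (1 - u) / N := by
    rw [div_lt_div_iff_of_pos_right hN']; linarith
  have hlt : (1 - u) / (N : ℝ) < 1 / N + ε := by
    have : (1 - u) / (N : ℝ) - 1 / N = -u / N := by field_simp; ring
    have h2 : -u / N < ε := by rw [div_lt_iff₀ hN']; linarith
    linarith
  have hne : (1 - u) / (N : ℝ) ≠ 1 / N := hgt.ne'
  have habs : |(1 - u) / (N : ℝ) - 1 / N| < ε := by
    rw [abs_sub_lt_iff]; constructor <;> linarith
  obtain ⟨hQ₀, htm⟩ := htame _ hne habs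
  obtain ⟨hBp, hρp'⟩ := hρp _ hgt hlt
  obtain ⟨hQl, hρl⟩ := hρL _ hτρ
  obtain ⟨hQq, hqq⟩ := hqL _ hτq
  have hmob : ((1 + (-1) * (u : ℂ)) / (0 + (N : ℂ) * u)) = ((((1 - u) / ((N : ℝ) * u)) : ℝ) : ℂ) := by
    push_cast; ring
  have hden : (0 : ℂ) + (N : ℂ) * u ≠ 0 := by rw [zero_add]; exact mul_ne_zero hNc huc
  have hQl' : Ql.eval ((1 + (-1) * (u : ℂ)) / (0 + (N : ℂ) * u)) ≠ 0 := by rw [hmob]; exact hQl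
  have hQq' : Qq.eval ((1 + (-1) * (u : ℂ)) / (0 + (N : ℂ) * u)) ≠ 0 := by rw [hmob]; exact hQq
  obtain ⟨hQl'', hlfrac⟩ := hl' (u : ℂ) hden hQl'
  obtain ⟨hQq'', hqfrac⟩ := hq' (u : ℂ) hden hQq'
  rw [hmob] at hlfrac hqfrac
  have hBpℓ : (Bp.comp ℓ).eval (u : ℂ) ≠ 0 := by rw [Polynomial.eval_comp, hℓev]; exact hBp
  have hQ₀ℓ : (Q₀.comp ℓ).eval (u : ℂ) ≠ 0 := by rw [Polynomial.eval_comp, hℓev]; exact hQ₀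
  obtain ⟨hQw, hsum⟩ := hw (u : ℂ) hBpℓ hQ₀ℓ hQq'' hQl''
  refine ⟨hQw, ?_⟩
  have hf : f ((1 - u) / ((N : ℝ) * u)) = (((-u : ℝ)) : ℂ) * f ((1 - u) / N) -
      q₀ ((1 - u) / ((N : ℝ) * u)) := by
    rw [← hγu]; ring
  have hfx : f ((1 - u) / N) = ρ ((1 - u) / N) + (g₀ ((1 - u) / N) +
      P₀.eval ((((1 - u) / N : ℝ)) : ℂ) / Q₀.eval ((((1 - u) / N : ℝ)) : ℂ)) := by
    rw [← htm]; ring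
  rw [hf, hfx, hρp', hqq, hρl, ← hsum]
  simp only [Polynomial.eval_comp, Polynomial.eval_neg, hℓev]
  rw [← hlfrac, ← hqfrac]
  push_cast
  ring

end Summit.Langlands.Langlands.Theorems
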